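import Summits.QuantumFields.YangMills.Theorems.BalabanUVNodesN13Cor3AsymJunctionThm2KeyedAtBgRegWindowSignFullBudgetAtRecord13CoPH
import Literature.MathematicalPhysics.QuantumFieldTheory.Balaban1983to89.B14Sum246Ratio
import Literature.MathematicalPhysics.QuantumFieldTheory.Balaban1983to89.B15Claim189FlowAtRecord

/-!
# BalabanUVNodes ∕ N13 — THE N11 → N13 EDGE END AT NODE 00's STAGE-13 RECORD, part 5: (2.46)'s TWO COUPLING-SMALLNESS ROWS (`Σ_{j≤n} g_j^{κ₀} ≤ g_n^{κ₀−6}`,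
# `R₁ g_n^{κ₀−6} ≤ 1`) READ FROM NODE O's β-FLOOR `FlowStep.BetaLowerH b γ β₁₃` (`b > 0`), THE RUN's WINDOW AND TWO EXPLICIT γ-NUMERICS — via pub-balaban's
# layer summability along a b-floored (0.20) flow (`B14Sum246Ratio.layerSum_le_of_betaLower`) read at the generated history of the record
# (Track A, DAG node N13 = [B16]; cluster K1 — K1⁷ `StabilityBAtRecordR13SepCoPH` = stmt-QuantumFields-20542, helper `--as helper`; seat `pub-ymgap-dag-n13-w2` g3, own-lineage
# successor of part 4 `…Thm2KeyedAtBgRegWindowSignFullBudgetAtRecord13CoPH`; 2026-08-28; count-neutral)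

[I] = [Balaban1987RG1] (0.18)–(0.20) pp. 255–256, §1 p. 264; [III] = [Balaban1988Convergent] Thm 2 and (2.45)–(2.46) p. 263, p. 264; [B16] = [Balaban1989LargeFieldII] (0.1)
p. 356, p. 387 ll. 21–27.
statement-level bookkeeping of a published proof with citation tags; proofs kernel-checked; nothing here is a claim about the Yang–Mills mass gap

CITATION HEADER (verbatim, text layer).  [III] p. 263, after (2.44): *"Similarly, taking Ω = B_j(Λ_j) in (2.44), and summing over j, we get"* (2.46) *"for κ₀ ≥ 7 and g
sufficiently small."*; p. 264: *"Corollary 3 (Ultraviolet Stability). Under the assumptions of Theorem 1 there exist constants E₋, E₊ independent of η and T, but depending on g_k,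
such that"* (2.50).  [I] p. 256: the recursion (0.20) `g_{k+1}⁻² = g_k⁻² − β_{k+1}(g_k)`.

WHY THIS FILE.  After parts 1–4 the END's Theorem-2 side still displayed (2.46)'s two smallness inputs `hsum : Σ_{j=1}^{n} g_j^{κ₀} ≤ g_n^{κ₀−6}` and
`hsmall6 : cR·K₀(4·2^d,2d)·g_n^{κ₀−6} ≤ 1` (`n ≤ k`).  Along a history generated by (0.20) with a POSITIVE β-floor `b` in the window, pub-balaban's T11.F module proves the
general-exponent layer summability `Σ_{j=1}^{n} g_j^κ ≤ 2g_n^{κ−2}∕((κ−2)b) + g_n^κ` (`B14Sum246Ratio.layerSum_le_of_betaLower`, over `Setup.Flow`); the record's run IS such a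
flow (`gOfRecord₁₃ = genSeq β₁₃ g₀` definitionally; `B15Claim189FlowAtRecord.satisfiesRG_genFlow_of_inInterval`, `beta_genFlow_succ_apply`), and NODE O's FLOOR letter
`BetaLowerH b γ β₁₃` (`b > 0`, the K1 engine's rung-2 `hO`) is exactly its floor hypothesis.  So `hsum` reduces to the numeric `γ⁴·(2∕((κ₀−2)b) + γ²) ≤ 1` and `hsmall6`
to `cR·K₀(4·2^d,2d)·γ^{κ₀−6} ≤ 1` (both «γ sufficiently small», p. 263), and part 4's SIGN row is the floor's shadow (`b > 0 ⇒ β ≥ 0`).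

WHAT THIS FILE PROVES (4 theorems, 0 `def`, 0 `sorry`; BY NAME over part 4, `B14Sum246Ratio.layerSum_le_of_betaLower`, `B15Claim189FlowAtRecord.{satisfiesRG_genFlow_of_inInterval,
beta_genFlow_succ_apply, genFlow_g_eq_genSeq}`).
§0 `sum_pow_le_pow_sub_six_of_betaFloor_of_inInterval` (generic `HBeta`: floor `b > 0` + window + `κ₀ ≥ 7` + the first numeric ⇒ `hsum`'s shape for every `n ≤ K`) ·
   `mul_pow_sub_six_le_one_of_inInterval` (window + the second numeric ⇒ `hsmall6`'s shape) · `betaLowerH_zero_of_pos` (floor ⇒ sign).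
§1 ★★★ `uvIneq_at_record₁₃CoPH_of_thm2Supply_chainWitness_atBgReg_of_betaFloor_window_of_fullBudget`.

HONEST SCOPE ∕ A6.  By-name junction + real-sequence bookkeeping (pub-balaban's, CITED, not re-proved); the FLOOR `b > 0` of `β₁₃` on the window box is NODE O's unprinted
asymptotic-freedom content ([I] p. 264; [II] (2.41); cell T09.F) — a HYPOTHESIS in the K1 engine's currency, inhabited at no θ in the tree; LOCATED as parts 1–4 (`hH` no
supplier; `hA'eq` ∕ `hφ1` identification rows; `hreg` = [15]); the supply tokens, the obligations, (1.79)∕(1.80)∕(1.80)⁺, the (1.90) gas stay HYPOTHESES; nothing of Bałaban's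
asserted; N11 ∕ N13 NOT discharged; K0⁷ ∕ K1⁷ NOT closed (`stub_nodes13PWS` ∕ `stub_runRows13PWS` NOT proved); counts UNMOVED (discharged 5∕27 · Track A 5∕28); one finite
`𝕋⁴_{L^K}` programme at fixed `ε = L^{−K}`, Bałaban AS PRINTED; R4 closes the conditional finite-𝕋⁴ rung `BalabanLadder.UV` only — the Yang–Mills mass gap (Clay) is NOT proved
by any of this; nothing continuum ∕ ℝ⁴ ∕ OS.  No `def`, no `sorry`, no `instance`, no `notation`. -/

noncomputable section

open MeasureTheory
open scoped BigOperators Matrix.Norms.L2Operator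

namespace Summit.QuantumFields.YangMills.BalabanUVNodes.N13Cor3AsymJunctionThm2KeyedAtBgRegBetaFloorFullBudgetAtRecord13CoPH

open Literature.MathematicalPhysics.QuantumFieldTheory.Balaban1983to89 Step B14.Eq225Concrete B14.LocalCoupling B14Thm2 Finset
open T4Continuum T4DatumAssembly Node00 DagBinding FlowStepRuns B15DeterminingSets
open B10Eq38TorusDomains (toFine)
open B16Cor3Ops (PosOp Repr172)
open TreeLengthTorus (tsys proj TPt TAdj)
open B13FamilySum (Ineq126 VolBound)
open B16Eq190Resummation (bracket mayerTerm F191 polys190 LocalOps DepOn)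
open B13ScaleTransfer (Pt FaceConnected)
open TreeLength (treeLen)
open B16SProfile (Sop)
open B13Factor210Literal (fineCubes)
open Summit.QuantumFields.YangMills.Theorems.BalabanUVNodesN11Sect3SupplyChainDefs (Sect3Supplier chainWitness)
open Summit.QuantumFields.YangMills.Theorems.BalabanUVNodesN11Sect3SupplyChainObligationsDefs (SupplierObligations NoExpansionObligation ChainFormAt
  chainFormAt_all_of_obligations)
open Summit.QuantumFields.YangMills.Theorems.BalabanUVNodesN11Thm2Sect2DataOfRecordKeyedDefs (sect2DataOfRecord₁₃Keyed)
open Summit.QuantumFields.YangMills.Theorems.BalabanUVNodesN11Thm2AlongSupplyChain (h248_chainWitness_of_chainFormAt)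

open Summit.QuantumFields.YangMills.Theorems.BalabanUVNodesN11Thm2SupplyDefs (Thm2ESupplyAt Thm2RSupplyAt ineq243_keyed_of_eSupply ineq244_keyed_of_rSupply)
open FlowStep (HBeta prefixOf Box mem_box BetaLowerH)
open B15Claim189FlowAtRecord (satisfiesRG_genFlow_of_inInterval beta_genFlow_succ_apply genFlow_g_eq_genSeq)
open Summit.QuantumFields.YangMills.BalabanUVNodes.N13Cor3AsymJunctionThm2KeyedAtBgRegWindowSignFullBudgetAtRecord13CoPH
  (uvIneq_at_record₁₃CoPH_of_thm2Supply_chainWitness_atBgReg_of_betaSign_window_of_fullBudget)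

/-! ## §0. (2.46)'s inputs along a b-floored (0.20) history in the window: layer summability, the `R₁`-smallness, floor ⇒ sign -/

/-- **`Σ_{j=1}^{n} g_j^{κ₀} ≤ g_n^{κ₀−6}` (1 ≤ n ≤ K) ALONG THE GENERATED HISTORY `genSeq β g₀` IN THE WINDOW `]0, γ]` WITH A β-FLOOR `b > 0` ON THE γ-BOX, `κ₀ ≥ 7`,
`γ⁴·(2∕((κ₀−2)b) + γ²) ≤ 1`** — pub-balaban's `B14Sum246Ratio.layerSum_le_of_betaLower` (`Σ_{j=1}^{n} g_j^κ ≤ 2g_n^{κ−2}∕((κ−2)b) + g_n^κ`) at the flow `genFlow β g₀`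
((0.20) in the window by `satisfiesRG_genFlow_of_inInterval`; floor at the run's own couplings by `beta_genFlow_succ_apply` + the box), then `g_n ≤ γ`.
[cite: Balaban1988Convergent, (2.46) p.263; Balaban1987RG1, (0.20) p.256] -/
theorem sum_pow_le_pow_sub_six_of_betaFloor_of_inInterval (β : HBeta) (g0 : ℝ) {b γ : ℝ} {K κ₀ : ℕ}
    (hb : 0 < b) (hfloor : BetaLowerH b γ β) (hI : Step.InInterval γ K (genSeq β g0)) (hκ : 7 ≤ κ₀)
    (hγ : γ ^ 4 * (2 / (((κ₀ : ℝ) - 2) * b) + γ ^ 2) ≤ 1) :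
    ∀ n, 1 ≤ n → n ≤ K → ∑ j ∈ Icc 1 n, genSeq β g0 j ^ κ₀ ≤ genSeq β g0 n ^ (κ₀ - 6) := by
  intro n _hn hnK
  have hpos : ∀ j, j ≤ K → 0 < (genFlow β g0).g j := fun j hj => (hI j hj).1
  have hrg := satisfiesRG_genFlow_of_inInterval β g0 hI
  have hlb : ∀ j, j < K → b ≤ (genFlow β g0).β (j + 1) ((genFlow β g0).g j) := fun j hj => by
    rw [genFlow_g_eq_genSeq, beta_genFlow_succ_apply]
    exact hfloor j _ (mem_box.mpr fun i => hI i (by have := i.isLt; omega))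
  have h := B14Sum246Ratio.layerSum_le_of_betaLower (genFlow β g0) K hb hpos hrg hlb (κ := κ₀) (by omega) hnK
  rw [genFlow_g_eq_genSeq] at h
  set g := genSeq β g0 n with hg
  have hg0 : 0 < g := (hI n hnK).1
  have hgγ : g ≤ γ := (hI n hnK).2
  have hc : 0 ≤ 2 / (((κ₀ : ℝ) - 2) * b) := by
    have : (0 : ℝ) < (κ₀ : ℝ) - 2 := by
      have : (7 : ℝ) ≤ κ₀ := by exact_mod_cast hκ
      linarith
    positivity
  have hsplit : 2 / (((κ₀ : ℝ) - 2) * b) * g ^ (κ₀ - 2) + g ^ κ₀ = g ^ (κ₀ - 6) * (g ^ 4 * (2 / (((κ₀ : ℝ) - 2) * b) + g ^ 2)) := by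
    have e1 : g ^ (κ₀ - 2) = g ^ (κ₀ - 6) * g ^ 4 := by rw [← pow_add]; congr 1; omega
    have e2 : g ^ κ₀ = g ^ (κ₀ - 6) * g ^ 6 := by rw [← pow_add]; congr 1; omega
    rw [e1, e2]; ring
  have hmono : g ^ 4 * (2 / (((κ₀ : ℝ) - 2) * b) + g ^ 2) ≤ γ ^ 4 * (2 / (((κ₀ : ℝ) - 2) * b) + γ ^ 2) := by
    have h4 : g ^ 4 ≤ γ ^ 4 := pow_le_pow_left₀ hg0.le hgγ 4
    have h2 : g ^ 2 ≤ γ ^ 2 := pow_le_pow_left₀ hg0.le hgγ 2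
    have : 0 ≤ γ ^ 4 := le_trans (by positivity) h4
    nlinarith [pow_nonneg hg0.le 4, pow_nonneg hg0.le 2]
  calc ∑ j ∈ Icc 1 n, genSeq β g0 j ^ κ₀ ≤ 2 / (((κ₀ : ℝ) - 2) * b) * g ^ (κ₀ - 2) + g ^ κ₀ := h
    _ = g ^ (κ₀ - 6) * (g ^ 4 * (2 / (((κ₀ : ℝ) - 2) * b) + g ^ 2)) := hsplit
    _ ≤ g ^ (κ₀ - 6) * 1 := mul_le_mul_of_nonneg_left (hmono.trans hγ) (pow_nonneg hg0.le _)
    _ = g ^ (κ₀ - 6) := mul_one _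

/-- **`c·g_n^{κ₀−6} ≤ 1` (1 ≤ n ≤ K) in the window from `c·γ^{κ₀−6} ≤ 1`** (`0 ≤ c`, `0 < g_n ≤ γ`). [cite: Balaban1988Convergent, (2.46) p.263 (bookkeeping)] -/
theorem mul_pow_sub_six_le_one_of_inInterval {g : ℕ → ℝ} {γ c : ℝ} {K κ₀ : ℕ} (hc : 0 ≤ c)
    (hI : Step.InInterval γ K g) (hγ : c * γ ^ (κ₀ - 6) ≤ 1) :
    ∀ n, 1 ≤ n → n ≤ K → c * g n ^ (κ₀ - 6) ≤ 1 := fun n _ hnK =>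
  (mul_le_mul_of_nonneg_left (pow_le_pow_left₀ (hI n hnK).1.le (hI n hnK).2 _) hc).trans hγ

/-- A positive β-floor on a box is in particular the sign `β ≥ 0` there (part 4's letter). [cite: Balaban1987RG1, §1 p.264 (bookkeeping)] -/
theorem betaLowerH_zero_of_pos {b γ : ℝ} {β : HBeta} (hb : 0 < b) (h : BetaLowerH b γ β) : BetaLowerH 0 γ β :=
  fun k v hv => hb.le.trans (h k v hv)
/-! ## §1. Part 4's END with (2.46)'s two rows read from the floor, the window and the two γ-numerics -/

section FloorEnd

variable (F : T4Family) (N : ℕ) [NeZero N]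
variable (θ : Stage13HParams F N) (h : θ.Provisos₁₃CoPH F N) (P : B12.RunParams) (k : ℕ)

open Classical in
/-- **★★★ (UV₁₃) AT LEVEL `k ≤ K` OF THE RUN `P` AT NODE 00's STAGE-13 RECORD — part 4's END with (2.46)'s TWO COUPLING-SMALLNESS ROWS READ FROM NODE O's β-FLOOR,
THE WINDOW AND TWO EXPLICIT γ-NUMERICS**: `uvIneq_at_record₁₃CoPH_of_thm2Supply_chainWitness_atBgReg_of_betaSign_window_of_fullBudget` with
`hsum : Σ_{j=1}^{n} g_j^{κ₀} ≤ g_n^{κ₀−6} (n ≤ k)` := §0 (pub-balaban's layer summability along the b-floored (0.20) flow `genFlow β₁₃ g₀`, then `g_n ≤ γ` and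
`γ⁴·(2∕((κ₀−2)b) + γ²) ≤ 1`), `hsmall6 : cR·K₀(4·2^d,2d)·g_n^{κ₀−6} ≤ 1` := `g_n ≤ γ` and `cR·K₀(4·2^d,2d)·γ^{κ₀−6} ≤ 1`, and the SIGN of part 4 := the FLOOR `bO > 0`
(`betaLowerH_zero_of_pos`).  Print p. 263: (2.46) *"for κ₀ ≥ 7 and γ sufficiently small"* — here the two numerics.  The floor `hfloor : FlowStep.BetaLowerH bO γ (betaOfRecord₁₃ …)`,
`0 < bO`, is NODE O's letter in the currency the K1 engine's rung 2 carries (`hO : ∃ b > 0, ∃ γO > 0, BetaLowerH b γO β₁₃`).  Everything else VERBATIM from part 4 (supply tokens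
on `bgReg`, `hreg`, `(hσ, hT)`, `hk`, the V-indexed history ∕ volumes ∕ seam `hA'eq`, `hφ ∕ hφ1`, vacuum, log sizes, budget data, (1.90) gas, `hH`).  CONDITIONAL on every input
— LOCATED as parts 1–4; the floor letter is a HYPOTHESIS, never asserted; nothing of Bałaban's asserted; N11 ∕ N13 NOT discharged; count-neutral.
[cite: Balaban1988Convergent, (2.46) p.263, Thm 2 p.263, (2.45)–(2.50) pp.263–264; Balaban1987RG1, (0.20) p.256, §1 p.264; Balaban1989LargeFieldII, (0.1) p.356, (1.72) p.379, p.387 ll.21–27] -/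
theorem uvIneq_at_record₁₃CoPH_of_thm2Supply_chainWitness_atBgReg_of_betaFloor_window_of_fullBudget (Nc : ℕ) [NeZero Nc] (R : Repr172 (GaugeField (F.P P.K) k (SU N)) (tsys 4 Nc).Dom)
    {M₁ : ℝ} (hM : M₁ ≠ 0) (hnum : (Fintype.card (Site (F.P P.K) k) : ℝ) = (M₁ * Nc) ^ 4)
    {κ₁ : ℝ} (hκ : B12TreeDecay.kappa₀ (4 * 2 ^ 4) (2 * 4) ≤ κ₁) (hκ₁ : 0 ≤ κ₁) (c₀ : ℝ)
    (hH : R.Holds (densOfRecord₁₃ F N θ.toStage13Params P k))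
    (hχ01 : ∀ a V, 0 ≤ R.χ a V ∧ R.χ a V ≤ 1)
    (h0χ : ∀ V, R.χ R.allSmall V = chiβOfRecord₁₃ F N θ.toStage13Params P.K (gOfRecord₁₃ F N θ.toStage13Params P) k V)
    -- the components of `Z_k`: composite structure and per-component (1.79)/(1.80) data
    (T : R.Adm → (tsys 4 Nc).Dom → PosOp (GaugeField (F.P P.K) k (SU N))) (l : R.Adm → List (tsys 4 Nc).Dom)
    (hnd : ∀ a, (l a).Nodup) (hset : ∀ a, (l a).toFinset = R.Zc a)
    (hTZ : ∀ a Fn V, (R.TZ a).T Fn V = (PosOp.pi (T a) (l a)).T Fn V)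
    (b : Step.Budget.Consts) (Lb : ℝ) {Rk q : ℕ} (hRk : 0 < Rk) (hq : 0 < q)
    (hC : 0 ≤ b.C) (hbM : 0 ≤ b.M) (hRm : ∀ m, 0 ≤ b.R m) (hdim : b.d = 4) (hRq : ((Rk * q : ℕ) : ℝ) = Lb * b.R (k + 1)) (hLb : 0 ≤ Lb)
    (hslope2 : 2 * (κ₁ * (4 * 2 ^ 4) * Lb ^ b.d) ≤ b.C * b.M ^ b.d * b.R (k + 1))
    (X₀ : R.Adm → (tsys 4 Nc).Dom → Finset (Pt 4)) (K : R.Adm → (tsys 4 Nc).Dom → ℕ)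
    (κ Pp : R.Adm → (tsys 4 Nc).Dom → ℝ) (s : R.Adm → (tsys 4 Nc).Dom → ℕ → ℝ)
    (hdataZ : ∀ a, ∀ X ∈ R.Zc a, (X₀ a X).Nonempty ∧ FaceConnected (X₀ a X) ∧
      X.1 = (fineCubes Rk (X₀ a X)).image (proj Nc) ∧ 1 ≤ K a X ∧
      (∀ V, (T a X).T 1 V ≤ Real.exp (-(κ a X) - Pp a X)) ∧ Step.Budget.Controls b k (K a X) (κ a X) (s a X) ∧
      (∀ m, 0 ≤ s a X m) ∧ s a X (k + 1) = treeLen (Sop q (X₀ a X)) ∧ c₀ ≤ Pp a X)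
    -- the domains `Y_i`: composite structure and per-domain (1.80)⁺ horizon-0 data
    (TY : R.Adm → (tsys 4 Nc).Dom → PosOp (GaugeField (F.P P.K) k (SU N))) (lY : R.Adm → List (tsys 4 Nc).Dom)
    (hndY : ∀ a, (lY a).Nodup) (hsetY : ∀ a, (lY a).toFinset = R.Ys a)
    (hTYs : ∀ a Fn V, (R.TYs a).T Fn V = (PosOp.pi (TY a) (lY a)).T Fn V)
    (SY : R.Adm → (tsys 4 Nc).Dom → Finset (Pt 4)) (κY PY : R.Adm → (tsys 4 Nc).Dom → ℝ) (sY : R.Adm → (tsys 4 Nc).Dom → ℕ → ℝ)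
    (hdataY : ∀ a, ∀ Y ∈ R.Ys a, (SY a Y).Nonempty ∧ FaceConnected (SY a Y) ∧
      Y.1 = (fineCubes Rk (SY a Y)).image (proj Nc) ∧ (∀ V, (TY a Y).T 1 V ≤ Real.exp (-(κY a Y) - PY a Y)) ∧
      Step.Budget.Controls b k 0 (κY a Y - κ₁ * treeLen (fineCubes Rk (SY a Y))) (sY a Y) ∧ c₀ ≤ PY a Y)
    -- the (1.90) gas of every admissible term (verbatim)
    {LF DomY Cube Var Sv : Type*} [Fintype LF] [Fintype DomY] [Fintype Cube] [DecidableEq LF] [DecidableEq DomY]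
    [DecidableEq Cube] {adjC : Cube → Cube → Prop} [DecidableRel adjC]
    (hrefl : ∀ a, adjC a a) (hsymm : ∀ a b, adjC a b → adjC b a)
    {locX : LF → Finset Cube} {locY : DomY → Finset Cube} {site : Var → Cube} (Yfix : R.Adm → Finset Cube)
    (houtX : ∀ a j, (locX j \ Yfix a).Nonempty) (houtY : ∀ a Y, (locY Y \ Yfix a).Nonempty)
    (Op : R.Adm → Finset LF → ((Var → Sv) → ℂ) →+ ((Var → Sv) → ℂ))
    (hOps : ∀ a, LocalOps adjC locX (Yfix a) site (Op a))
    (hOpReal : ∀ a (S : Finset LF) (f : (Var → Sv) → ℂ), (∀ ψ, (f ψ).im = 0) → ∀ φ, (Op a S f φ).im = 0)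
    (Vt : R.Adm → DomY → (Var → Sv) → ℂ) (hV : ∀ a Y, DepOn (Yfix a) site (Vt a Y) (locY Y))
    (hVreal : ∀ a Y ψ, (Vt a Y ψ).im = 0) (cfg : GaugeField (F.P P.K) k (SU N) → (Var → Sv))
    {nbr : Cube → Finset Cube} (hnbr : ∀ a b, adjC a b → a ∈ nbr b) {νn : ℝ} (hν : ∀ b, ((nbr b).card : ℝ) ≤ νn)
    {d : R.Adm → Finset Cube → ℝ} {c₁ Rr κc K₀ cv τ : ℝ} (hd : ∀ a X, 0 ≤ d a X) (hc₁ : 0 ≤ c₁) (hK₀ : 0 ≤ K₀) (hτ : 0 ≤ τ)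
    (h197 : ∀ a V X, ‖F191 adjC locX locY (Yfix a) (mayerTerm (Op a) (Vt a) (cfg V)) X‖ ≤ c₁ * Real.exp (-(Rr * d a X)))
    (h126 : ∀ a, Ineq126 (polys190 adjC locX locY (Yfix a)) (fun X => X \ Yfix a) (d a) κc K₀)
    (hvol : ∀ a, VolBound (polys190 adjC locX locY (Yfix a)) (fun X => X \ Yfix a) (d a) cv)
    (hrate : κc + τ * cv ≤ Rr) (hsmall : c₁ * Real.exp (τ * cv) * K₀ * νn ≤ τ)
    (hjunction : ∀ a V, R.curly a V = (bracket (Op a) (Vt a) (cfg V)).re)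
    {πc : ℝ} (hQ : (Fintype.card Cube : ℝ) ≤ πc * (Fintype.card (Site (F.P P.K) k) : ℝ))
    -- dag-n11-e's supply chain on the live-selector line and [III] §3's two SUPPLY TOKENS at the chain witness ON PRINT's CLASS `bgReg`
    (σ : Sect3Supplier θ P)
    (hsel : θ.ppSel = ppSelLiveOfRecord F N θ.ν θ.τ9 (EOfRecord₁₃ F N θ.toStage13Params) (wOfRecord₉ F N θ.toStage9Params))
    (hθ : θ.Admissible F N) (hE₀ : 0 ≤ θ.s2.lf.E₀) (hB₀ : 0 ≤ θ.s2.lf.B₀) (hMτ : 1 ≤ θ.τ9.M)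
    (hκd : B12TreeDecay.kappa₀ (4 * 2 ^ (F.P P.K).d) (2 * (F.P P.K).d) ≤ θ.s2.lf.κ)
    (hσ : SupplierObligations θ P σ) (hT : NoExpansionObligation θ P σ)
    {bE cE κR cR : ℝ} {κ₀ : ℕ}
    (hES : Thm2ESupplyAt θ P (fun k s => (chainWitness θ P σ k).1 s) (fun k _ => bgReg F N P.K k θ.εbg) bE cE)
    (hRS : Thm2RSupplyAt θ P (fun k s => (chainWitness θ P σ k).1 s) (fun k _ => bgReg F N P.K k θ.εbg) κR cR κ₀)
    (hb1 : bE < 1) (hL : 1 < ((F.P P.K).L : ℝ)) (hκ7 : 7 ≤ κ₀)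
    -- NODE O's FLOOR `b > 0` of the record's β-functions on the window box, the run's window, and (2.46)'s two γ-numerics («γ sufficiently small»)
    {γ bO : ℝ} (hbO : 0 < bO) (hfloor : BetaLowerH bO γ (betaOfRecord₁₃ F N θ.toStage13Params))
    (hI : Step.InInterval γ P.K (gOfRecord₁₃ F N θ.toStage13Params P))
    (hγ246 : γ ^ 4 * (2 / (((κ₀ : ℝ) - 2) * bO) + γ ^ 2) ≤ 1) (hγR : cR * B12TreeDecay.K₀ (4 * 2 ^ (F.P P.K).d) (2 * (F.P P.K).d) * γ ^ (κ₀ - 6) ≤ 1)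
    (hreg : ∀ k (s : SeqOfRecord F θ.ν θ.τ9.M (gOfRecord₁₃ F N θ.toStage13Params P) P.K k) (U : GaugeField (F.P P.K) 0 (SU N)), U ∈ bgReg F N P.K k θ.εbg →
      ∀ j, 1 ≤ j → j ≤ k → ∀ X, Sect2.admB (F.P P.K) θ.ν θ.τ9.M (gOfRecord₁₃ F N θ.toStage13Params P) s.Ω s.Λ j (Sect2.domSites (F.P P.K) θ.τ9.M j X) = true →
        Sect2.ofBackgroundC (ιSU N) U ∈ Sect2.spaceMS (settingOfRecord₁₃ F N θ.toStage13Params P) (θ.rzAt P s) θ.τ9.M j (Sect2.domSites (F.P P.K) θ.τ9.M j X) s.Ω)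
    (hk : k ≤ P.K)
    -- the configuration-indexed data READ THROUGH THE CARRIER: history, fluctuation argument, volumes (region and ring)
    (sV : (V : GaugeField (F.P P.K) k (SU N)) → SeqOfRecord F θ.ν θ.τ9.M (gOfRecord₁₃ F N θ.toStage13Params P) P.K k)
    (aV : GaugeField (F.P P.K) k (SU N) → Tk.SFluct (F.P P.K) (FluctV N))
    (Ek EkLog EkRest : ℝ) (hEk : Ek = EkLog + EkRest) (E₂ : ℝ) (Γ : ℕ → ℝ)
    (hΓvol : ∀ V, ∀ n, 1 ≤ n → n ≤ k → ((univ.filter fun y : Site (F.P P.K) n => toFine n y ∈ gammaRegion (sV V).Ω k n).card : ℝ) ≤ Γ n)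
    (hΓr : ∀ V, ∀ n, 1 ≤ n → n ≤ k →
      ((univ.filter fun c : TPt (F.P P.K).d (Sect2.domCount (F.P P.K) θ.τ9.M n) =>
          (Sect2.domSites (F.P P.K) θ.τ9.M n (Sect2.cubeDom (F.P P.K) θ.τ9.M n c) ∩
              Sect2.enlT (F.P P.K) (Sect2.zSide (F.P P.K) θ.ν θ.τ9.M (gOfRecord₁₃ F N θ.toStage13Params P) n) 1 ((sV V).Λ n)ᶜ).Nonempty ∧
            ∃ c', (c' = c ∨ TAdj c' c) ∧ (Sect2.domSites (F.P P.K) θ.τ9.M n (Sect2.cubeDom (F.P P.K) θ.τ9.M n c') ∩ (sV V).Ω n).Nonempty).card : ℝ) ≤ Γ n)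
    (hφ : ∀ V, ∀ j, 1 ≤ j → j ≤ k → ∀ x, θ.Phih P k (sV V).Ω (sV V).Λ j x ≤ 1)
    (hφ1 : ∀ V, chiβOfRecord₁₃ F N θ.toStage13Params P.K (gOfRecord₁₃ F N θ.toStage13Params P) k V ≠ 0 →
      ∀ j, 1 ≤ j → j ≤ k → ∀ x, θ.Phih P k (sV V).Ω (sV V).Λ j x = 1)
    (hvac : VacuumRestBound EkRest E₂ Γ k)
    (hA'eq : ∀ V, R.A' V =
      (sect2ActionDataOfRecord F N (FluctV N) P.K (settingOfRecord₁₃ F N θ.toStage13Params P) (θ.rzAt P (sV V)) (sV V)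
        ((chainWitness θ P σ k).1 (sV V)) (aV V) Ek).action23 k (Uk F N P.K k θ.εbg V))
    -- the sizes of the logarithmic vacuum term, the volume majorant, the sign of the `E₁`-free part of Theorem 2's constant
    {cΓ cL cL' : ℝ} (hrest : 0 ≤ 1 + 2 * (θ.s2.lf.B₀ * B12TreeDecay.K₀ (4 * 2 ^ (F.P P.K).d) (2 * (F.P P.K).d)) + E₂)
    (hΓ : ∑ n ∈ Icc 1 k, Γ n ≤ cΓ * (Fintype.card (Site (F.P P.K) k) : ℝ))
    (hlog : -(cL * (Fintype.card (Site (F.P P.K) k) : ℝ)) ≤ -EkLog)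
    (hlog' : -EkLog ≤ cL' * (Fintype.card (Site (F.P P.K) k) : ℝ)) :
    ∀ V : GaugeField (F.P P.K) k (SU N),
      B16.UVIneq ((datumOfRecord₁₃CoPH F N θ h).C P) k V
        ((cE * (1 - ((F.P P.K).L : ℝ) ^ (-(1 - bE)))⁻¹ + 1 + 2 * (θ.s2.lf.B₀ * B12TreeDecay.K₀ (4 * 2 ^ (F.P P.K).d) (2 * (F.P P.K).d)) + E₂) * cΓ + cL +
          πc * (c₁ * Real.exp (τ * cv) * K₀))
        ((cE * (1 - ((F.P P.K).L : ℝ) ^ (-(1 - bE)))⁻¹ + 1 + 2 * (θ.s2.lf.B₀ * B12TreeDecay.K₀ (4 * 2 ^ (F.P P.K).d) (2 * (F.P P.K).d)) + E₂) * cΓ + cL' +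
          πc * (c₁ * Real.exp (τ * cv) * K₀) + M₁⁻¹ ^ 4 * B12TreeDecay.K₀ (4 * 2 ^ 4) (2 * 4) * ∑ _i : Fin 2, Real.exp (-c₀)) :=
  uvIneq_at_record₁₃CoPH_of_thm2Supply_chainWitness_atBgReg_of_betaSign_window_of_fullBudget F N θ h P k Nc R hM hnum hκ hκ₁ c₀ hH hχ01 h0χ T l hnd hset
    hTZ b Lb hRk hq hC hbM hRm hdim hRq hLb hslope2 X₀ K κ Pp s hdataZ TY lY hndY hsetY hTYs SY κY PY sY hdataY hrefl hsymm Yfix houtX houtY Op hOps hOpReal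
    Vt hV hVreal cfg hnbr hν hd hc₁ hK₀ hτ h197 h126 hvol hrate hsmall hjunction hQ σ hsel hθ hE₀ hB₀ hMτ hκd hσ hT hES hRS hb1 hL hκ7
    (betaLowerH_zero_of_pos hbO hfloor) hI hreg hk sV aV Ek EkLog EkRest hEk E₂ Γ hΓvol hΓr hφ hφ1
    (fun n hn hnk => sum_pow_le_pow_sub_six_of_betaFloor_of_inInterval (betaOfRecord₁₃ F N θ.toStage13Params) P.g0 hbO hfloor hI hκ7 hγ246 n hn
      (hnk.trans hk))
    (fun n hn hnk => mul_pow_sub_six_le_one_of_inInterval (mul_nonneg hRS.nonneg (le_of_lt (B12TreeDecay.K₀_pos _ _))) hI hγR n hn (hnk.trans hk))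
    hvac hA'eq hrest hΓ hlog hlog'

end FloorEnd

end Summit.QuantumFields.YangMills.BalabanUVNodes.N13Cor3AsymJunctionThm2KeyedAtBgRegBetaFloorFullBudgetAtRecord13CoPH

end
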